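import Summits.HodgeConjecture.HodgeConjecture.Theorems.R90S6CompactFactorCanonicalDrop   -- ★ U1B F2 p865178: `setOf_fst_mem_compactCore_eq_compactCore_of_mem_center`; brings ★ U1B F1 p864945 (`mem_centralizer_prod_singleton_iff_of_mem_center`, `conj_prod_eq_of_mem_center`, `exists_homeomorph_quotient_centralizer_prod_of_mem_center`, `classOrbitalIntegral_comp_fst_eq_orbitalIntegral_map_symm`, `orbitalIntegral_prod_tensor_map_eq_of_mem_center`, `mem_center_cmLocal_one`), ★ `InvariantQuotientBlockDescent`, ★ `OrbitalMeasureCanonicalAtPoint`, ★ `CompactCoreLevelPoint`, ★ `ClosedCompactDecomposition`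
import Literature.NumberTheory.Automorphic.UnitOrbitalIntegralFixedPointsPair                 -- ★ `compactSpace_cmDatum_local_one_of_smul_eq`, `cmLocalIntegralLevel_one_eq_top_of_smul_eq` (the `K₁ = ⊤` payer: norm-one ⇒ unit)
import HarnessLib

/-!
# R90 · S6 «Ch. 14.1–14.5 stable trace formula» — CARD U1B FILE 3 «SOCKET-MEASURE ADAPTER»: THE COMPACT-FACTOR DROP IN THE SOCKET'S CURRENCY `(pr₁)_* ν_H = ν₁`
# — `Φ(⟦(γ₁, a)⟧, f₁ ∘ pr₁; m_H) = Φ(⟦γ₁⟧, f₁; m₁)` EXACTLY, for the socket's own Haar letter `ν_H` (`Theorems/R90S6SocketHaarProductSplit.lean`)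

Dealer R90-C14-plan (g3) RULINGS #7 (R30) 2026-09-05T03:44:34Z: «U1B FILE 3 SOCKET-MEASURE ADAPTER … so that ★ F2's `hν`∕`hν₂` are discharged IN THE SOCKET'S CURRENCY
(K2E3-p34 (G5): the `_hμu`-family binder payer)».  CENSUS FINDING (03:56Z): the floor socket `StubR90ExtE1HeckeFL` binds the Borel σ-algebra on the PRODUCT
`H_v = U(Φ₂)(L⁺_v) × U(Φ₁)(L⁺_v)` (`[MeasurableSpace (U2 × U1)] [BorelSpace …]`, an arbitrary Borel structure), so a product-measure identity `ν_H = ν₁ ⊗ ν₂` (★ F2's `hν`,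
which lives on `Prod.instMeasurableSpace`) cannot be fed from the socket.  The tree currency that survives is the PUSH-FORWARD `(pr₁)_* ν_H = ν₁` (★
`LocalTransferCompactSideJunctionCM` §1; ★ `IsCanonical.classOrbitalIntegral_comp_fst_eq_of_compactSpace_of_map_fst`'s `hν₁ : Measure.map Prod.fst ν = ν₁`), and ★
`InvariantQuotientBlockDescent` is robust to the ambient σ-algebra (its `G` is abstract with its own Borel binder; the auxiliary Haar measure on the compact factor is absent from
the conclusion).  THIS FILE re-cuts ★ F2 in that currency: the second Haar measure `ν₂` DISAPPEARS and the constant is `1`.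

THE MATHEMATICS [Rogawski1990 §4.3 (4.3.1) p. 43, L. 4.9.3 p. 56; DeitmarEchterhoff2014 Thm. 1.5.3; Folland1995 §2.6 (2.52)].  `G₁`, `G₂` second countable locally compact groups,
`G₂` COMPACT, `ν_H` a Haar measure on `G₁ × G₂` for ANY Borel structure on the product, `ν₁ := (pr₁)_* ν_H` — a Haar measure on `G₁` (§1: `pr₁` is a continuous proper surjective
homomorphism), right invariant when `ν_H` is, with `ν₁(K) = ν_H(K × G₂)`.  For `γ` with `γ.2` central, U1B's `e : G₁ ⧸ C(γ.1) ≃ₜ (G₁ × G₂) ⧸ C(γ)`, and the NORMALISED torus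
measures `t`, `t₁` (mass one on the compact cores): **`(e⁻¹)_* (ν_H ∕ t) = ν₁ ∕ t₁`** (§2 HEAD; ★ `exists_smul_map_block_quotientMeasure` at the block `refl` with the Borel structure
of `G₂` and its Haar measure chosen INSIDE the proof; pinning clause on (positive compact `K₀`) × (compact core, ★ F2 §1) × `G₂`: `c · 1 · ν₁(K₀) = ν_H(K₀ × G₂) · 1 = ν₁(K₀)`, so
`c = 1`).  Hence (§3) for canonical families `m_H` (for `(P, ν_H)`) and `m₁` (for `(P₁, ν₁)`): **`Φ(⟦(γ₁, a)⟧, f₁ ∘ pr₁; m_H) = Φ(⟦γ₁⟧, f₁; m₁)`** at EVERY pinned class, `a` central,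
every Banach-valued `f₁` — and `Φ(⟦(γ₁, a)⟧, ξ ⊗ χ; m_H) = Φ(⟦γ₁⟧, ξ; m₁) · χ(a)`.  §4, AT THE SOCKET'S LETTERS (`w ∣ v` non-split: `c • w = w`): `U(Φ₁)(L⁺_v)` is compact and
`K_{1,v} = U(Φ₁)(L⁺_v)` (★ `compactSpace_cmDatum_local_one_of_smul_eq`, ★ `cmLocalIntegralLevel_one_eq_top_of_smul_eq`), so the socket's pin `ν_H(K_{2,v} × K_{1,v}) = 1` reads
`ν₁(K_{2,v}) = 1`, and the pair identity holds with NO compactness ∕ centrality ∕ product hypothesis left — the consumer sets `ν₁ := Measure.map Prod.fst (νH v)`.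

* §1 `tendsto_fst_cocompact_of_compactSpace`, `isHaarMeasure_map_fst_prod_of_compactSpace`, `isMulRightInvariant_map_fst_prod`, `map_fst_apply_coe_prod_top`.
* §2 **`map_symm_quotientMeasure_centralizer_eq_of_map_fst_eq`** (HEAD).
* §3 `map_symm_apply_eq_quotientMeasure_of_isCanonical_of_map_fst_eq`, `classOrbitalIntegral_comp_fst_eq_orbitalIntegral_of_isCanonical_of_map_fst_eq`,
  **`classOrbitalIntegral_comp_fst_mk_eq_of_isCanonical_of_map_fst_eq`**, `classOrbitalIntegral_tensor_mk_eq_of_isCanonical_of_map_fst_eq`.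
* §4 `map_fst_apply_eq_one_of_prod_cmLocalIntegralLevel_one`, **`classOrbitalIntegral_comp_fst_mk_eq_of_isCanonical_cmLocalH_of_map_fst_eq`**,
  `classOrbitalIntegral_tensor_mk_eq_of_isCanonical_cmLocalH_of_map_fst_eq`.

Cell `hodgecm-mathlib`, crux H413 (`stmt-HodgeConjecture-24833`), route of record `HCCMUnconditional`; programme R90-TF (brief `director/R90-BRIEF.v2.md` 1f40d54518340a35),
section S6 (base `R90-C14`), seat R90-C14-p01 (g3).  Lane `--kind proof --supports stmt-HodgeConjecture-24833 --as helper`; THEOREMS ONLY (no definition, no instance, no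
notation, no named fact, no kit, no `sorry`); imports ★ U1B F2 + ★ `UnitOrbitalIntegralFixedPointsPair` + HarnessLib; never `Lines/`.  HONEST LABEL: measure-theoretic pairing,
count-neutral until the E1.3.7.2 ∕ E1.3.9 (G5) consumer uses it; proves no printed global statement, discharges no citation; HC_CM is proved only modulo the 7 printed citations
(2 remaining named inputs: hLiu418 = stmt-HodgeConjecture-24832, h413 = stmt-HodgeConjecture-24833) until rung 0 closes.

## References
* [Rogawski1990] J. D. Rogawski, *Automorphic Representations of Unitary Groups in Three Variables*, Ann. of Math. Stud. 123 (1990): §4.3 (4.3.1) p. 43, L. 4.9.3 p. 56,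
  §4.8 Case (a) p. 53, §1.7 p. 6.
* [DeitmarEchterhoff2014] A. Deitmar, S. Echterhoff, *Principles of Harmonic Analysis*, 2nd ed. (2014), Thm. 1.5.3, Cor. 1.5.4.
* [Folland1995] G. B. Folland, *A Course in Abstract Harmonic Analysis* (1995), §2.2, §2.6 Thm. 2.49, (2.52).
* [Gelbart1975] S. Gelbart, *Automorphic forms on adele groups*, Ann. of Math. Stud. 83 (1975), p. 155 (10.19).
-/

set_option autoImplicit false
-- the mandated namespace repeats the single-problem summit's segment (`HodgeConjecture.HodgeConjecture`)
set_option linter.dupNamespace false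

noncomputable section

open MeasureTheory Measure Set Function Filter Topology
open scoped ENNReal NNReal
open Literature.MeasureTheory.Group Literature.NumberTheory.Automorphic Literature.NumberTheory.Rogawski1990

namespace Summit.HodgeConjecture.HodgeConjecture.R90.S6

/-! ## §1 The push-forward `(pr₁)_* ν_H` along the compact factor -/

section MapFst

variable {G₁ G₂ : Type*} [Group G₁] [Group G₂] [TopologicalSpace G₁] [TopologicalSpace G₂]
  [IsTopologicalGroup G₁] [IsTopologicalGroup G₂] [CompactSpace G₂]
  [MeasurableSpace (G₁ × G₂)] [BorelSpace (G₁ × G₂)] [MeasurableSpace G₁] [BorelSpace G₁]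
  (νH : Measure (G₁ × G₂))

omit [Group G₁] [Group G₂] [IsTopologicalGroup G₁] [IsTopologicalGroup G₂] [MeasurableSpace (G₁ × G₂)] [BorelSpace (G₁ × G₂)] [MeasurableSpace G₁] [BorelSpace G₁] in
/-- `pr₁ : G₁ × G₂ → G₁` is proper for `G₂` compact (`pr₁⁻¹(Kᶜ) = (K × G₂)ᶜ`). [cite: Folland1995, §2.2] -/
theorem tendsto_fst_cocompact_of_compactSpace : Tendsto (Prod.fst : G₁ × G₂ → G₁) (cocompact (G₁ × G₂)) (cocompact G₁) := by
  rw [hasBasis_cocompact.tendsto_right_iff]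
  intro K hK
  filter_upwards [(hK.prod isCompact_univ).compl_mem_cocompact] with x hx
  simp only [mem_compl_iff, mem_prod, mem_univ, and_true] at hx
  exact hx

/-- **`(pr₁)_* ν_H` is a Haar measure on `G₁`** for `G₂` compact and ANY Borel structure on `G₁ × G₂` (Mathlib `isHaarMeasure_map` along the continuous proper surjective
homomorphism `MonoidHom.fst`) — the GENERIC form of ★ `Literature.NumberTheory.Rogawski1990.isHaarMeasure_map_fst_of_compactSpace` (`LocalTransferCompactSideJunctionCM` §1,
stated there for the CM carriers `U(Φ₂)_v × U(Φ₁)_v` only). [cite: Folland1995, §2.2] [cite: DeitmarEchterhoff2014, Cor. 1.5.4] -/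
theorem isHaarMeasure_map_fst_prod_of_compactSpace [νH.IsHaarMeasure] : (Measure.map (Prod.fst : G₁ × G₂ → G₁) νH).IsHaarMeasure :=
  isHaarMeasure_map νH (MonoidHom.fst G₁ G₂) continuous_fst Prod.fst_surjective tendsto_fst_cocompact_of_compactSpace

omit [CompactSpace G₂] in
/-- `(pr₁)_* ν_H` is right invariant when `ν_H` is (`pr₁ (p · (g, 1)) = pr₁ p · g`). [cite: Folland1995, §2.2] -/
theorem isMulRightInvariant_map_fst_prod [νH.IsMulRightInvariant] : (Measure.map (Prod.fst : G₁ × G₂ → G₁) νH).IsMulRightInvariant := by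
  refine ⟨fun g => ?_⟩
  rw [Measure.map_map (measurable_mul_const g) continuous_fst.measurable]
  have h : (fun x : G₁ => x * g) ∘ (Prod.fst : G₁ × G₂ → G₁) = (Prod.fst : G₁ × G₂ → G₁) ∘ fun p : G₁ × G₂ => p * (g, 1) := by
    funext p; rfl
  rw [h, ← Measure.map_map continuous_fst.measurable (measurable_mul_const _), map_mul_right_eq_self]

omit [IsTopologicalGroup G₁] [IsTopologicalGroup G₂] [CompactSpace G₂] in
/-- `((pr₁)_* ν_H)(K) = ν_H(K × G₂)` for a (measurable) subgroup `K ≤ G₁` — the socket's level pin `ν_H(K₂ × K₁) = 1` read on `G₁` once `K₁ = ⊤`. [cite: Rogawski1990, §1.7 p. 6] -/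
theorem map_fst_apply_coe_prod_top (K : Subgroup G₁) (hK : MeasurableSet (K : Set G₁)) :
    Measure.map (Prod.fst : G₁ × G₂ → G₁) νH K = νH ((K.prod (⊤ : Subgroup G₂) : Subgroup (G₁ × G₂)) : Set (G₁ × G₂)) := by
  rw [Measure.map_apply continuous_fst.measurable hK, Subgroup.coe_prod, Subgroup.coe_top, prod_univ]

end MapFst

/-! ## §2 HEAD: `(e⁻¹)_* (ν_H ∕ t) = ν₁ ∕ t₁` for the normalised torus measures, `ν₁ = (pr₁)_* ν_H` -/

section Head

variable {G₁ G₂ : Type*} [Group G₁] [Group G₂] [TopologicalSpace G₁] [TopologicalSpace G₂]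
  [IsTopologicalGroup G₁] [IsTopologicalGroup G₂] [LocallyCompactSpace G₁] [LocallyCompactSpace G₂]
  [SecondCountableTopology G₁] [SecondCountableTopology G₂] [T2Space G₁] [T2Space G₂] [CompactSpace G₂]
  [MeasurableSpace G₁] [BorelSpace G₁] [MeasurableSpace (G₁ × G₂)] [BorelSpace (G₁ × G₂)]

/-- **HEAD — THE CANONICAL COMPACT-FACTOR DROP IN `(pr₁)_*` CURRENCY.**  `G₂` compact, ANY Borel structure on `G₁ × G₂`, `γ.2` central,
`e : G₁ ⧸ C(γ.1) ≃ₜ (G₁ × G₂) ⧸ C(γ)` with `e(x C(γ.1)) = (x, 1) C(γ)` (★ U1B), `t` on `C(γ)` and `t₁` on `C(γ.1)` inversion-invariant Haar with MASS ONE ON THE COMPACT CORES,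
`ν_H` Haar on `G₁ × G₂`, `ν₁ = (pr₁)_* ν_H`:  `(e⁻¹)_* (ν_H ∕ t) = ν₁ ∕ t₁`, i.e. `Measure.map e.symm (quotientMeasure C(γ) t _ ν_H) = quotientMeasure C(γ.1) t₁ _ ν₁`
(★ `exists_smul_map_block_quotientMeasure` at the block `refl`, the Borel structure and Haar measure of `G₂` chosen inside the proof; scalar pinned to `1`).
[cite: DeitmarEchterhoff2014, Thm. 1.5.3] [cite: Folland1995, §2.6 (2.52)] [cite: Rogawski1990, §4.3 (4.3.1) p. 43] -/
theorem map_symm_quotientMeasure_centralizer_eq_of_map_fst_eq (γ : G₁ × G₂) (hγ : γ.2 ∈ Subgroup.center G₂)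
    [MeasurableSpace (G₁ ⧸ Subgroup.centralizer ({γ.1} : Set G₁))] [BorelSpace (G₁ ⧸ Subgroup.centralizer ({γ.1} : Set G₁))]
    [MeasurableSpace ((G₁ × G₂) ⧸ Subgroup.centralizer ({γ} : Set (G₁ × G₂)))]
    [BorelSpace ((G₁ × G₂) ⧸ Subgroup.centralizer ({γ} : Set (G₁ × G₂)))]
    (e : G₁ ⧸ Subgroup.centralizer ({γ.1} : Set G₁) ≃ₜ (G₁ × G₂) ⧸ Subgroup.centralizer ({γ} : Set (G₁ × G₂)))
    (he : ∀ x : G₁, e (QuotientGroup.mk x) = QuotientGroup.mk (x, 1))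
    (t : Measure (Subgroup.centralizer ({γ} : Set (G₁ × G₂)))) [t.IsHaarMeasure] [t.IsInvInvariant]
    (ht : t (compactCore (Subgroup.centralizer ({γ} : Set (G₁ × G₂)))) = 1)
    (t₁ : Measure (Subgroup.centralizer ({γ.1} : Set G₁))) [t₁.IsHaarMeasure] [t₁.IsInvInvariant]
    (ht₁ : t₁ (compactCore (Subgroup.centralizer ({γ.1} : Set G₁))) = 1)
    (ν₁ : Measure G₁) [ν₁.IsHaarMeasure] [ν₁.IsMulRightInvariant]
    (νH : Measure (G₁ × G₂)) [νH.IsHaarMeasure] [νH.IsMulRightInvariant] (hν₁ : Measure.map (Prod.fst : G₁ × G₂ → G₁) νH = ν₁) :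
    Measure.map e.symm (quotientMeasure (Subgroup.centralizer ({γ} : Set (G₁ × G₂))) t (isClosed_coe_centralizer_singleton γ) νH) =
      quotientMeasure (Subgroup.centralizer ({γ.1} : Set G₁)) t₁ (isClosed_coe_centralizer_singleton γ.1) ν₁ := by
  -- the auxiliary Borel structure and Haar measure on the compact factor (absent from the statement)
  letI : MeasurableSpace G₂ := borel G₂
  haveI : BorelSpace G₂ := ⟨rfl⟩
  haveI : (Measure.haar : Measure G₂).IsMulRightInvariant := isMulRightInvariant_of_compactSpace _
  haveI : (Measure.haar : Measure G₂).IsInvInvariant := isInvInvariant_of_compactSpace _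
  -- the block: `eM = refl`, `T = C(γ)`, `A = C(γ.1)`, `Ψ = e⁻¹`
  have hTA : ∀ g : G₁ × G₂, g ∈ Subgroup.centralizer ({γ} : Set (G₁ × G₂)) ↔
      ((ContinuousMulEquiv.refl (G₁ × G₂)) g).1 ∈ Subgroup.centralizer ({γ.1} : Set G₁) :=
    fun g => mem_centralizer_prod_singleton_iff_of_mem_center γ hγ g
  have hΨ : ∀ b : G₁, e.symm.symm (QuotientGroup.mk b) = QuotientGroup.mk ((ContinuousMulEquiv.refl (G₁ × G₂)).symm (b, 1)) :=
    fun b => by rw [Homeomorph.symm_symm, he]; rfl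
  obtain ⟨c, -, hmap, hpin⟩ := exists_smul_map_block_quotientMeasure (ContinuousMulEquiv.refl (G₁ × G₂))
    (Subgroup.centralizer ({γ} : Set (G₁ × G₂))) (isClosed_coe_centralizer_singleton γ) (Subgroup.centralizer ({γ.1} : Set G₁))
    (isClosed_coe_centralizer_singleton γ.1) hTA e.symm hΨ t νH t₁ ν₁ (Measure.haar : Measure G₂)
  -- pin the constant on `K₀ × compactCore × univ`
  obtain ⟨K₀⟩ := (inferInstance : Nonempty (TopologicalSpace.PositiveCompacts G₁))
  have hKpos : 0 < ν₁ K₀ := measure_pos_of_nonempty_interior ν₁ K₀.interior_nonempty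
  have hKfin : ν₁ K₀ < ⊤ := K₀.isCompact.measure_lt_top
  have h := hpin (K₀ : Set G₁) (Subtype.val '' compactCore (Subgroup.centralizer ({γ.1} : Set G₁))) Set.univ
  have hset : {s : Subgroup.centralizer ({γ} : Set (G₁ × G₂)) |
      ((ContinuousMulEquiv.refl (G₁ × G₂)) (s : G₁ × G₂)).1 ∈ Subtype.val '' compactCore (Subgroup.centralizer ({γ.1} : Set G₁)) ∧
        ((ContinuousMulEquiv.refl (G₁ × G₂)) (s : G₁ × G₂)).2 ∈ (Set.univ : Set G₂)} =
      compactCore (Subgroup.centralizer ({γ} : Set (G₁ × G₂))) :=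
    setOf_fst_mem_compactCore_eq_compactCore_of_mem_center γ hγ
  have hpre : (ContinuousMulEquiv.refl (G₁ × G₂)) ⁻¹' ((K₀ : Set G₁) ×ˢ (Set.univ : Set G₂)) = (Prod.fst : G₁ × G₂ → G₁) ⁻¹' (K₀ : Set G₁) := by
    rw [prod_univ]; rfl
  rw [hset, ht, mul_one, hpre, Subtype.val_injective.preimage_image, ht₁, mul_one,
    ← Measure.map_apply continuous_fst.measurable K₀.isCompact.measurableSet, hν₁] at h
  have hc : (c : ℝ≥0∞) = 1 := by
    have h' : (c : ℝ≥0∞) * ν₁ K₀ = 1 * ν₁ K₀ := by rw [one_mul]; exact h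
    exact (ENNReal.mul_left_inj hKpos.ne' hKfin.ne).1 h'
  rw [hmap, ENNReal.smul_def, hc, one_smul]

end Head

/-! ## §3 Canonical families in `(pr₁)_*` currency: the exact pairing at every pinned class -/

section Family

variable {G₁ G₂ : Type*} [Group G₁] [Group G₂] [TopologicalSpace G₁] [TopologicalSpace G₂]
  [IsTopologicalGroup G₁] [IsTopologicalGroup G₂] [LocallyCompactSpace G₁] [LocallyCompactSpace G₂]
  [SecondCountableTopology G₁] [SecondCountableTopology G₂] [T2Space G₁] [T2Space G₂] [CompactSpace G₂]
  [MeasurableSpace G₁] [BorelSpace G₁] [MeasurableSpace (G₁ × G₂)] [BorelSpace (G₁ × G₂)]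
  [∀ a : G₁, MeasurableSpace (G₁ ⧸ Subgroup.centralizer ({a} : Set G₁))]
  [∀ a : G₁, BorelSpace (G₁ ⧸ Subgroup.centralizer ({a} : Set G₁))]
  [∀ p : G₁ × G₂, MeasurableSpace ((G₁ × G₂) ⧸ Subgroup.centralizer ({p} : Set (G₁ × G₂)))]
  [∀ p : G₁ × G₂, BorelSpace ((G₁ × G₂) ⧸ Subgroup.centralizer ({p} : Set (G₁ × G₂)))]
  {P : G₁ × G₂ → Prop} {νH : Measure (G₁ × G₂)} [νH.IsHaarMeasure] [νH.IsMulRightInvariant] {mH : OrbitalMeasureFamily (G₁ × G₂)}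
  {P₁ : G₁ → Prop} {m₁ : OrbitalMeasureFamily G₁}

/-- **A canonical member pulled back along `e`, `(pr₁)_*` currency**: `(e⁻¹)_* (m_H c) = ν₁ ∕ t₁` for ANY normalised `t₁` at `(out c).1`.
[cite: Rogawski1990, §4.3 (4.3.1) p. 43] [cite: DeitmarEchterhoff2014, Thm. 1.5.3] -/
theorem map_symm_apply_eq_quotientMeasure_of_isCanonical_of_map_fst_eq (hm : mH.IsCanonical P νH)
    (ν₁ : Measure G₁) [ν₁.IsHaarMeasure] [ν₁.IsMulRightInvariant] (hν₁ : Measure.map (Prod.fst : G₁ × G₂ → G₁) νH = ν₁)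
    (c : ConjClasses (G₁ × G₂)) (hc : P (Quotient.out c)) (hγ : (Quotient.out c : G₁ × G₂).2 ∈ Subgroup.center G₂)
    (e : G₁ ⧸ Subgroup.centralizer ({(Quotient.out c : G₁ × G₂).1} : Set G₁) ≃ₜ
      (G₁ × G₂) ⧸ Subgroup.centralizer ({(Quotient.out c : G₁ × G₂)} : Set (G₁ × G₂)))
    (he : ∀ x : G₁, e (QuotientGroup.mk x) = QuotientGroup.mk (x, 1))
    (t₁ : Measure (Subgroup.centralizer ({(Quotient.out c : G₁ × G₂).1} : Set G₁))) [t₁.IsHaarMeasure] [t₁.IsInvInvariant]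
    (ht₁ : t₁ (compactCore (Subgroup.centralizer ({(Quotient.out c : G₁ × G₂).1} : Set G₁))) = 1) :
    Measure.map e.symm (mH c) =
      quotientMeasure (Subgroup.centralizer ({(Quotient.out c : G₁ × G₂).1} : Set G₁)) t₁
        (isClosed_coe_centralizer_singleton (Quotient.out c : G₁ × G₂).1) ν₁ := by
  obtain ⟨t, htH, htI, htc, hmc⟩ := hm c hc
  rw [hmc]
  exact map_symm_quotientMeasure_centralizer_eq_of_map_fst_eq (Quotient.out c) hγ e he t htc t₁ ht₁ ν₁ νH hν₁

/-- **Canonical H-side orbital integral of `f₁ ∘ pr₁` = the orbital integral of `f₁` at `(out c).1` against `ν₁ ∕ t₁`**, for ANY normalised `t₁`, `ν₁ = (pr₁)_* ν_H`;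
Banach-valued `f₁`, no continuity or integrability hypothesis. [cite: Rogawski1990, §4.3 (4.3.1) p. 43; L. 4.9.3 p. 56] [cite: Gelbart1975, p. 155 (10.19)] -/
theorem classOrbitalIntegral_comp_fst_eq_orbitalIntegral_of_isCanonical_of_map_fst_eq (hm : mH.IsCanonical P νH)
    (ν₁ : Measure G₁) [ν₁.IsHaarMeasure] [ν₁.IsMulRightInvariant] (hν₁ : Measure.map (Prod.fst : G₁ × G₂ → G₁) νH = ν₁)
    (c : ConjClasses (G₁ × G₂)) (hc : P (Quotient.out c)) (hγ : (Quotient.out c : G₁ × G₂).2 ∈ Subgroup.center G₂)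
    (t₁ : Measure (Subgroup.centralizer ({(Quotient.out c : G₁ × G₂).1} : Set G₁))) [t₁.IsHaarMeasure] [t₁.IsInvInvariant]
    (ht₁ : t₁ (compactCore (Subgroup.centralizer ({(Quotient.out c : G₁ × G₂).1} : Set G₁))) = 1)
    {E : Type*} [NormedAddCommGroup E] [NormedSpace ℝ E] (f₁ : G₁ → E) :
    classOrbitalIntegral mH (f₁ ∘ Prod.fst) c =
      orbitalIntegral (Quotient.out c : G₁ × G₂).1 f₁
        (quotientMeasure (Subgroup.centralizer ({(Quotient.out c : G₁ × G₂).1} : Set G₁)) t₁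
          (isClosed_coe_centralizer_singleton (Quotient.out c : G₁ × G₂).1) ν₁) := by
  obtain ⟨h, h1, -⟩ := exists_homeomorph_quotient_centralizer_prod_of_mem_center (Quotient.out c : G₁ × G₂) hγ
  have h1' : ∀ x : G₁, h.toMeasurableEquiv (QuotientGroup.mk x) = QuotientGroup.mk (x, 1) := fun x => by
    rw [Homeomorph.toMeasurableEquiv_coe, h1]
  rw [classOrbitalIntegral_comp_fst_eq_orbitalIntegral_map_symm mH c h.toMeasurableEquiv h1' f₁, Homeomorph.toMeasurableEquiv_symm_coe,
    map_symm_apply_eq_quotientMeasure_of_isCanonical_of_map_fst_eq hm ν₁ hν₁ c hc hγ h h1 t₁ ht₁]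

/-- **EXACT PAIR FOR CANONICAL FAMILIES AT EVERY PINNED CLASS, `(pr₁)_*` currency.**  `G₂` compact, ANY Borel structure on `G₁ × G₂`, `m_H` canonical for `(P, ν_H)`,
`ν₁ = (pr₁)_* ν_H`, `m₁` canonical for `(P₁, ν₁)`; at `(γ₁, a)` with `a` central and pinned classes, for EVERY `f₁ : G₁ → E`:
`Φ(⟦(γ₁, a)⟧, f₁ ∘ pr₁; m_H) = Φ(⟦γ₁⟧, f₁; m₁)` — ★ `IsCanonical.classOrbitalIntegral_comp_fst_eq_of_compactSpace_of_map_fst` WITHOUT `C(γ₁)` compact and WITHOUT continuity.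
[cite: Rogawski1990, §4.3 (4.3.1) p. 43; L. 4.9.3 p. 56] [cite: Gelbart1975, p. 155 (10.19)] [cite: DeitmarEchterhoff2014, Thm. 1.5.3] -/
theorem classOrbitalIntegral_comp_fst_mk_eq_of_isCanonical_of_map_fst_eq (hm : mH.IsCanonical P νH)
    (ν₁ : Measure G₁) [ν₁.IsHaarMeasure] [ν₁.IsMulRightInvariant] (hν₁ : Measure.map (Prod.fst : G₁ × G₂ → G₁) νH = ν₁)
    (hm₁ : m₁.IsCanonical P₁ ν₁) (γ₁ : G₁) (a : G₂) (ha : a ∈ Subgroup.center G₂)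
    (hc : P (Quotient.out (ConjClasses.mk (γ₁, a)))) (hc₁ : P₁ (Quotient.out (ConjClasses.mk γ₁)))
    {E : Type*} [NormedAddCommGroup E] [NormedSpace ℝ E] (f₁ : G₁ → E) :
    classOrbitalIntegral mH (f₁ ∘ Prod.fst) (ConjClasses.mk (γ₁, a)) = classOrbitalIntegral m₁ f₁ (ConjClasses.mk γ₁) := by
  -- the representative `out ⟦(γ₁, a)⟧ = z (γ₁, a) z⁻¹ = (z.1 γ₁ z.1⁻¹, a)`
  obtain ⟨z, hz⟩ := isConj_iff.1 (ConjClasses.mk_eq_mk_iff_isConj.1 (Quotient.out_eq (ConjClasses.mk (γ₁, a))).symm)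
  have hq : (Quotient.out (ConjClasses.mk (γ₁, a)) : G₁ × G₂) = (z.1 * γ₁ * z.1⁻¹, a) := by
    rw [← hz]; exact conj_prod_eq_of_mem_center (γ₁, a) ha z
  have hγ : (Quotient.out (ConjClasses.mk (γ₁, a)) : G₁ × G₂).2 ∈ Subgroup.center G₂ := by rw [hq]; exact ha
  have hmk₁ : ConjClasses.mk (Quotient.out (ConjClasses.mk (γ₁, a)) : G₁ × G₂).1 = ConjClasses.mk γ₁ := by
    rw [hq]; exact ConjClasses.mk_eq_mk_iff_isConj.2 (isConj_iff.2 ⟨z.1, rfl⟩).symm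
  have hc₁' : P₁ (Quotient.out (ConjClasses.mk (Quotient.out (ConjClasses.mk (γ₁, a)) : G₁ × G₂).1)) := by rw [hmk₁]; exact hc₁
  -- a normalised inversion-invariant Haar measure on `C((out c).1)` (from `m₁`, read at the point)
  obtain ⟨t₁, ht₁H, ht₁I, ht₁c, -⟩ := hm₁.atPoint_eq_quotientMeasure (Quotient.out (ConjClasses.mk (γ₁, a)) : G₁ × G₂).1 hc₁'
  rw [classOrbitalIntegral_comp_fst_eq_orbitalIntegral_of_isCanonical_of_map_fst_eq hm ν₁ hν₁ _ hc hγ t₁ ht₁c f₁,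
    ← hm₁.classOrbitalIntegral_mk_eq_orbitalIntegral hc₁' t₁ ht₁c f₁, hmk₁]

/-- **The `ξ ⊗ χ` form, `(pr₁)_*` currency**: `Φ(⟦(γ₁, a)⟧, Φ; m_H) = Φ(⟦γ₁⟧, ξ; m₁) · χ(a)` for complex `Φ(x, k) = ξ(x) χ(k)`, `a` central, pinned classes.
[cite: Rogawski1990, L. 4.9.3 p. 56] [cite: Gelbart1975, p. 155 (10.19)] -/
theorem classOrbitalIntegral_tensor_mk_eq_of_isCanonical_of_map_fst_eq (hm : mH.IsCanonical P νH)
    (ν₁ : Measure G₁) [ν₁.IsHaarMeasure] [ν₁.IsMulRightInvariant] (hν₁ : Measure.map (Prod.fst : G₁ × G₂ → G₁) νH = ν₁)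
    (hm₁ : m₁.IsCanonical P₁ ν₁) (γ₁ : G₁) (a : G₂) (ha : a ∈ Subgroup.center G₂)
    (hc : P (Quotient.out (ConjClasses.mk (γ₁, a)))) (hc₁ : P₁ (Quotient.out (ConjClasses.mk γ₁)))
    {Φ : G₁ × G₂ → ℂ} {ξ : G₁ → ℂ} {χ : G₂ → ℂ} (hΦ : ∀ x k, Φ (x, k) = ξ x * χ k) :
    classOrbitalIntegral mH Φ (ConjClasses.mk (γ₁, a)) = classOrbitalIntegral m₁ ξ (ConjClasses.mk γ₁) * χ a := by
  obtain ⟨z, hz⟩ := isConj_iff.1 (ConjClasses.mk_eq_mk_iff_isConj.1 (Quotient.out_eq (ConjClasses.mk (γ₁, a))).symm)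
  have hq : (Quotient.out (ConjClasses.mk (γ₁, a)) : G₁ × G₂) = (z.1 * γ₁ * z.1⁻¹, a) := by
    rw [← hz]; exact conj_prod_eq_of_mem_center (γ₁, a) ha z
  have hγ : (Quotient.out (ConjClasses.mk (γ₁, a)) : G₁ × G₂).2 ∈ Subgroup.center G₂ := by rw [hq]; exact ha
  have hq2 : (Quotient.out (ConjClasses.mk (γ₁, a)) : G₁ × G₂).2 = a := by rw [hq]
  have hmk₁ : ConjClasses.mk (Quotient.out (ConjClasses.mk (γ₁, a)) : G₁ × G₂).1 = ConjClasses.mk γ₁ := by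
    rw [hq]; exact ConjClasses.mk_eq_mk_iff_isConj.2 (isConj_iff.2 ⟨z.1, rfl⟩).symm
  have hc₁' : P₁ (Quotient.out (ConjClasses.mk (Quotient.out (ConjClasses.mk (γ₁, a)) : G₁ × G₂).1)) := by rw [hmk₁]; exact hc₁
  obtain ⟨t₁, ht₁H, ht₁I, ht₁c, -⟩ := hm₁.atPoint_eq_quotientMeasure (Quotient.out (ConjClasses.mk (γ₁, a)) : G₁ × G₂).1 hc₁'
  obtain ⟨h, h1, -⟩ := exists_homeomorph_quotient_centralizer_prod_of_mem_center (Quotient.out (ConjClasses.mk (γ₁, a)) : G₁ × G₂) hγ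
  have h1' : ∀ x : G₁, h.toMeasurableEquiv (QuotientGroup.mk x) = QuotientGroup.mk (x, 1) := fun x => by
    rw [Homeomorph.toMeasurableEquiv_coe, h1]
  rw [classOrbitalIntegral_eq, ← MeasurableEquiv.map_map_symm h.toMeasurableEquiv (ν := mH (ConjClasses.mk (γ₁, a))),
    orbitalIntegral_prod_tensor_map_eq_of_mem_center _ hγ h.toMeasurableEquiv h1' hΦ, Homeomorph.toMeasurableEquiv_symm_coe,
    map_symm_apply_eq_quotientMeasure_of_isCanonical_of_map_fst_eq hm ν₁ hν₁ _ hc hγ h h1 t₁ ht₁c,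
    ← hm₁.classOrbitalIntegral_mk_eq_orbitalIntegral hc₁' t₁ ht₁c ξ, hmk₁, hq2]

end Family

/-! ## §4 At the socket's letters: `H_v = G₁ × U(Φ₁)(L⁺_v)`, `w ∣ v` non-split -/

section CM

open NumberField IsDedekindDomain

variable (L : Type) [Field L] [NumberField L] [IsCMField L] (Φ₁ : Matrix (Fin 1) (Fin 1) L)
  {v : HeightOneSpectrum (𝓞 ↥(maximalRealSubfield L))} (w : UnitaryGroup.PlacesOver L v) (hw : IsCMField.complexConj L • w.1 = w.1)
  (hΦ₁ : IsUnit (UnitaryGroup.placeForm Φ₁ w.1))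
  {G₁ : Type*} [Group G₁] [TopologicalSpace G₁] [IsTopologicalGroup G₁] [LocallyCompactSpace G₁] [SecondCountableTopology G₁] [T2Space G₁]
  [MeasurableSpace G₁] [BorelSpace G₁]
  [MeasurableSpace (G₁ × (UnitaryGroup.cmDatum L 1 Φ₁).Local v)] [BorelSpace (G₁ × (UnitaryGroup.cmDatum L 1 Φ₁).Local v)]

omit [IsTopologicalGroup G₁] [LocallyCompactSpace G₁] [SecondCountableTopology G₁] [T2Space G₁] in
include hw hΦ₁ in
/-- **The socket's level pin read on `G₁`**: at a non-split `w ∣ v` with `Φ₁` unimodular at `w`, `K_{1,v} = U(Φ₁)(L⁺_v)` (★ `cmLocalIntegralLevel_one_eq_top_of_smul_eq`: norm-one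
elements are units), so `ν_H(K × K_{1,v}) = 1` gives `((pr₁)_* ν_H)(K) = 1` (for the socket: `K = K_{2,v}`, `hΦ₁ := isUnit_placeForm_antidiagOne 1 w.1`).
[cite: Rogawski1990, §1.7 p. 6; §4.9 p. 55] -/
theorem map_fst_apply_eq_one_of_prod_cmLocalIntegralLevel_one (νH : Measure (G₁ × (UnitaryGroup.cmDatum L 1 Φ₁).Local v))
    (K : Subgroup G₁) (hK : MeasurableSet (K : Set G₁))
    (h1 : νH ((K.prod (UnitaryGroup.cmLocalIntegralLevel L 1 Φ₁ v) : Subgroup (G₁ × (UnitaryGroup.cmDatum L 1 Φ₁).Local v)) :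
      Set (G₁ × (UnitaryGroup.cmDatum L 1 Φ₁).Local v)) = 1) :
    Measure.map (Prod.fst : G₁ × (UnitaryGroup.cmDatum L 1 Φ₁).Local v → G₁) νH K = 1 := by
  rw [map_fst_apply_coe_prod_top νH K hK, ← UnitaryGroup.cmLocalIntegralLevel_one_eq_top_of_smul_eq L Φ₁ w hw hΦ₁, h1]

variable [∀ a : G₁, MeasurableSpace (G₁ ⧸ Subgroup.centralizer ({a} : Set G₁))]
  [∀ a : G₁, BorelSpace (G₁ ⧸ Subgroup.centralizer ({a} : Set G₁))]
  [∀ p : G₁ × (UnitaryGroup.cmDatum L 1 Φ₁).Local v,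
    MeasurableSpace ((G₁ × (UnitaryGroup.cmDatum L 1 Φ₁).Local v) ⧸ Subgroup.centralizer ({p} : Set (G₁ × (UnitaryGroup.cmDatum L 1 Φ₁).Local v)))]
  [∀ p : G₁ × (UnitaryGroup.cmDatum L 1 Φ₁).Local v,
    BorelSpace ((G₁ × (UnitaryGroup.cmDatum L 1 Φ₁).Local v) ⧸ Subgroup.centralizer ({p} : Set (G₁ × (UnitaryGroup.cmDatum L 1 Φ₁).Local v)))]
  {P : G₁ × (UnitaryGroup.cmDatum L 1 Φ₁).Local v → Prop} {νH : Measure (G₁ × (UnitaryGroup.cmDatum L 1 Φ₁).Local v)}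
  [νH.IsHaarMeasure] [νH.IsMulRightInvariant] {mH : OrbitalMeasureFamily (G₁ × (UnitaryGroup.cmDatum L 1 Φ₁).Local v)}
  {P₁ : G₁ → Prop} {m₁ : OrbitalMeasureFamily G₁}

include hw hΦ₁ in
/-- **(CM, socket currency) EXACT PAIR on `G₁ × U(Φ₁)(L⁺_v)` at a non-split place**: `m_H` canonical for `(P, ν_H)` (ANY Borel structure on the product, as the socket binds it),
`m₁` canonical for `(P₁, (pr₁)_* ν_H)`; then at EVERY `(γ₁, a)` with pinned classes and every Banach-valued `f₁`,
`Φ(⟦(γ₁, a)⟧, f₁ ∘ pr₁; m_H) = Φ(⟦γ₁⟧, f₁; m₁)` — compactness (★ `compactSpace_cmDatum_local_one_of_smul_eq`) and centrality (★ U1B `mem_center_cmLocal_one`) discharged.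
[cite: Rogawski1990, §4.3 (4.3.1) p. 43; L. 4.9.3 p. 56; §4.8 Case (a) p. 53] [cite: Gelbart1975, p. 155 (10.19)] -/
theorem classOrbitalIntegral_comp_fst_mk_eq_of_isCanonical_cmLocalH_of_map_fst_eq (hm : mH.IsCanonical P νH)
    (ν₁ : Measure G₁) [ν₁.IsHaarMeasure] [ν₁.IsMulRightInvariant]
    (hν₁ : Measure.map (Prod.fst : G₁ × (UnitaryGroup.cmDatum L 1 Φ₁).Local v → G₁) νH = ν₁)
    (hm₁ : m₁.IsCanonical P₁ ν₁) (γ₁ : G₁) (a : (UnitaryGroup.cmDatum L 1 Φ₁).Local v)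
    (hc : P (Quotient.out (ConjClasses.mk (γ₁, a)))) (hc₁ : P₁ (Quotient.out (ConjClasses.mk γ₁)))
    {E : Type*} [NormedAddCommGroup E] [NormedSpace ℝ E] (f₁ : G₁ → E) :
    classOrbitalIntegral mH (f₁ ∘ Prod.fst) (ConjClasses.mk (γ₁, a)) = classOrbitalIntegral m₁ f₁ (ConjClasses.mk γ₁) := by
  haveI : CompactSpace ((UnitaryGroup.cmDatum L 1 Φ₁).Local v) := UnitaryGroup.compactSpace_cmDatum_local_one_of_smul_eq L Φ₁ w hw hΦ₁
  exact classOrbitalIntegral_comp_fst_mk_eq_of_isCanonical_of_map_fst_eq hm ν₁ hν₁ hm₁ γ₁ a (mem_center_cmLocal_one L Φ₁ v a) hc hc₁ f₁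

include hw hΦ₁ in
/-- **(CM, socket currency) the `ξ ⊗ χ` form**: `Φ(⟦(γ₁, a)⟧, Φ; m_H) = Φ(⟦γ₁⟧, ξ; m₁) · χ(a)` for complex `Φ(x, k) = ξ(x) χ(k)` (the `U(1)`-character bookkeeping of L. 4.9.3).
[cite: Rogawski1990, L. 4.9.3 p. 56] [cite: Gelbart1975, p. 155 (10.19)] -/
theorem classOrbitalIntegral_tensor_mk_eq_of_isCanonical_cmLocalH_of_map_fst_eq (hm : mH.IsCanonical P νH)
    (ν₁ : Measure G₁) [ν₁.IsHaarMeasure] [ν₁.IsMulRightInvariant]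
    (hν₁ : Measure.map (Prod.fst : G₁ × (UnitaryGroup.cmDatum L 1 Φ₁).Local v → G₁) νH = ν₁)
    (hm₁ : m₁.IsCanonical P₁ ν₁) (γ₁ : G₁) (a : (UnitaryGroup.cmDatum L 1 Φ₁).Local v)
    (hc : P (Quotient.out (ConjClasses.mk (γ₁, a)))) (hc₁ : P₁ (Quotient.out (ConjClasses.mk γ₁)))
    {Φ : G₁ × (UnitaryGroup.cmDatum L 1 Φ₁).Local v → ℂ} {ξ : G₁ → ℂ} {χ : (UnitaryGroup.cmDatum L 1 Φ₁).Local v → ℂ}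
    (hΦ : ∀ x k, Φ (x, k) = ξ x * χ k) :
    classOrbitalIntegral mH Φ (ConjClasses.mk (γ₁, a)) = classOrbitalIntegral m₁ ξ (ConjClasses.mk γ₁) * χ a := by
  haveI : CompactSpace ((UnitaryGroup.cmDatum L 1 Φ₁).Local v) := UnitaryGroup.compactSpace_cmDatum_local_one_of_smul_eq L Φ₁ w hw hΦ₁
  exact classOrbitalIntegral_tensor_mk_eq_of_isCanonical_of_map_fst_eq hm ν₁ hν₁ hm₁ γ₁ a (mem_center_cmLocal_one L Φ₁ v a) hc hc₁ hΦ

end CM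

end Summit.HodgeConjecture.HodgeConjecture.R90.S6

end
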